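import Mathlib.Algebra.GroupWithZero.WithZero
import Mathlib.Data.ZMod.Basic
import Mathlib.GroupTheory.SpecificGroups.Cyclic
import Mathlib.FieldTheory.Finite.Basic
import Mathlib.Algebra.GroupWithZero.Units.Fintype
import Mathlib.Algebra.MonoidAlgebra.Basic
import HarnessLib

/-!
# Points of affine monoid schemes (`𝔽₁`-schemes à la Deitmar / Connes–Consani): `X(𝔽_{1^{q−1}}) ≃ X_ℤ(𝔽_q)`, and the Frobenius-fixed `𝔽_{1^N}`-points

Deitmar's `𝔽₁`-schemes [Deitmar2006ZetaKTheoryF1, §1–§2] are glued from spectra of commutative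
monoids `A`; the base extension to `ℤ` of `spec A` is `Spec ℤ[A]` ("`A ⊗ ℤ` … the monoidal ring `ℤ[A]`.
This defines a functor from monoids to rings which is left adjoint to the forgetful functor that
sends a ring `R` to the multiplicative monoid `(R, ×)`", §1 p. 142), and points are Hom-sets: for
`X = spec(A)`, "`X(spec(D_k)) = Hom(A, D_k)`" where "`C_{k−1}` denote[s] the cyclic group of `k − 1`
elements and … `D_k` [is] the monoid `C_{k−1} ∪ {0}`, where `x·0 = 0`" (§2 p. 143).  The proof of
his Theorem 1 rests on two facts: "`#X_ℤ(𝔽_q) = #X(D_q)`, where `X(D) = Hom(D, X)` as usual" and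
"Note that if `q` is a prime power, then `D_q ≅ (𝔽_q, ×)`" (§2 p. 143; Remark 1: "`X(𝔽_q) ≅ X_ℤ(𝔽_q)`
… for `k ∈ ℕ` one sets `𝔽_k = D_k`").  Connes–Consani [ConnesConsani2010SchemesF1, Thm. 4.10 (2) and
its proof] state the same agreement for their `𝔽₁`-schemes: `#X(𝔽_{1^n})` (the functor evaluated on
the monoid `𝔽₁[H]`, `H = ℤ/nℤ`) "agrees with the cardinality of `X(𝔽_q)` when `n = q − 1`": "In the
case of a finite field `𝔽_q`, the corresponding monoid is `𝔽₁[H]` for the cyclic group `H = ℤ/nℤ` of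
order `n = q − 1`."  The monoid `𝔽_{1^n} = μ_n ∪ {0}` (Kapranov–Smirnov's extensions of `𝔽₁`,
[ConnesConsaniMarcolli2009, §3]: "those defined over the extension `𝔽_{1^n}` correspond to sets with a
free action of the group `ℤ/nℤ`") carries the Frobenius endomorphisms `x ↦ x^k`
([ConnesConsaniMarcolli2009, Prop. 5.1, Thm. 6.2 (b)]: on `μ^{(m)}` the `σ_{p^ℓ}`, `e(r) ↦ e(p^ℓ r)`,
"coincide with the Frobenius morphism").

This file records, fully PROVED (no named facts), for AFFINE monoid schemes `X = spec A`
(`A` any commutative monoid; points `Points A M := A →* M`):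

* §1 `F1Ext N := WithZero (Multiplicative (ZMod N))` — the monoid `𝔽_{1^N} = μ_N ∪ {0} = D_{N+1}`
  (`card_F1Ext`: `N + 1` elements); `deitmarMonoidEquiv : 𝔽_{1^{q−1}} ≃* (𝔽_q, ×)` for every finite
  field (Deitmar's "`D_q ≅ (𝔽_q, ×)`", via the cyclicity of `𝔽_qˣ`); `intPointsEquiv :
  Hom_Ring(ℤ[A], S) ≃ Hom_Mon(A, (S, ×))` (the adjunction, `X_ℤ(S) = X((S, ×))`); hence
  `pointsF1ExtEquiv : X(𝔽_{1^{q−1}}) ≃ X_ℤ(𝔽_q)` and `card_points_F1Ext` — Connes–Consani's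
  Thm. 4.10 (2) / Deitmar's `#X_ℤ(𝔽_q) = #X(D_q)` for affine `X`, with NO torsion-freeness hypothesis.
* §2 the Frobenius `frob N q : x ↦ x^q` of `𝔽_{1^N}`; its fixed submonoid is `𝔽_{1^{gcd(N, q−1)}}`
  (`fixedEquivF1Ext`: `{0} ∪ μ_N[q−1]`, and the `(q−1)`-torsion of the cyclic group `μ_N` is cyclic of
  order `gcd(N, q−1)`); the `𝔽_{1^N}`-points of `X` fixed by post-composition with `frob N q` are the
  `𝔽_{1^{gcd(N,q−1)}}`-points (`frobFixedPointsEquiv`, `card_frobFixedPoints`), and for `q − 1 ∣ N`,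
  `q = #𝔽`, they are equinumerous with `X_ℤ(𝔽_q) = Hom(ℤ[A], 𝔽_q)`
  (`card_frobFixedPoints_eq_card_intPoints`) — the Weil-type reading "Frobenius-fixed points over the
  big extension = rational points" for this geometry.

What is NOT here: gluing / non-affine monoid schemes (Deitmar's Theorem 1 reduces to the affine case
by inclusion–exclusion over an affine cover), the zeta-polynomial `N(x)` and condition
`(q − 1, e) = 1` themselves (for the group `A = ℤ/rℤ` these are in
`Literature.Barriers.RiemannHypothesis.IntegralLambdaRingsCyclotomic` §7), Connes–Consani's graded
functor `\underline X` on `𝔽₁[H]` for all abelian groups `H`, and any zeta function.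

## References (read at the page)

* [Deitmar2006ZetaKTheoryF1] A. Deitmar, *Remarks on zeta functions and `K`-theory over `𝔽₁`*, Proc.
  Japan Acad. Ser. A 82 (2006) 141–146: §1 p. 142 (`𝔽₁`-schemes, `A ⊗ ℤ = ℤ[A]` left adjoint to
  `R ↦ (R, ×)`), §2 p. 143 (`D_k = C_{k−1} ∪ {0}`; `#X_ℤ(𝔽_q) = #X(D_q)`; `D_q ≅ (𝔽_q, ×)`;
  `X(spec(D_k)) = Hom(A, D_k)`; `Hom(S_𝔭, C_{k−1}) = Hom(Quot(S_𝔭), C_{k−1})`), Remark 1.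
* [ConnesConsani2010SchemesF1] A. Connes, C. Consani, *Schemes over `𝔽₁` and zeta functions*,
  Compos. Math. 146 (2010) = arXiv:0903.2024: Thm. 4.10 (2) and its proof (p. 17 of the arXiv text).
* [ConnesConsaniMarcolli2009] A. Connes, C. Consani, M. Marcolli, *Fun with `𝔽₁`*, J. Number Theory
  129 (2009) = arXiv:0806.2401: §3 (`𝔽_{1^n}`, Kapranov–Smirnov), Prop. 5.1, Remark 5.2, Thm. 6.2.
* [IrelandRosen1990] K. Ireland, M. Rosen, *A Classical Introduction to Modern Number Theory*,
  GTM 84: Ch. 4 §1 Thm. 1 (`𝔽_qˣ` is cyclic), Ch. 3 §3 Prop. 3.3.1 (number of solutions of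
  `ax ≡ b (m)`) — via Mathlib's `IsCyclic` instance for `𝔽ˣ` and `IsCyclic.card_powMonoidHom_ker`.
-/

noncomputable section

open scoped Classical

namespace Literature.AlgebraicGeometry.F1Schemes

/-! ## §1. `𝔽_{1^N} = μ_N ∪ {0}`, points of `spec A`, and `X(𝔽_{1^{q−1}}) ≃ X_ℤ(𝔽_q)` -/

/-- **The monoid `𝔽_{1^N} = μ_N ∪ {0}`** (Deitmar's `D_{N+1} = C_N ∪ {0}` with `x·0 = 0`;
Connes–Consani's `𝔽₁[H]`, `H = ℤ/Nℤ`; Kapranov–Smirnov's `𝔽_{1^N}`): the cyclic group of order `N`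
(written multiplicatively) with a zero adjoined — a commutative group with zero.
[cite: Deitmar2006ZetaKTheoryF1, §2 p. 143 (`D_k = C_{k−1} ∪ {0}`)] [cite: ConnesConsani2010SchemesF1, Thm. 4.10 proof (`𝔽₁[H]`, `H = ℤ/nℤ`)] -/
abbrev F1Ext (N : ℕ) : Type :=
  WithZero (Multiplicative (ZMod N))

/-- **Points of the affine monoid scheme `spec A` with values in a monoid `M`**: `X(M) = Hom(A, M)`
("`X(spec(D_k)) = Hom(A, D_k)`"; "`X(D) = Hom(D, X)` as usual"). [cite: Deitmar2006ZetaKTheoryF1, §2 p. 143] -/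
abbrev Points (A M : Type*) [MulOneClass A] [MulOneClass M] : Type _ :=
  A →* M

/-- `Nat.card (Multiplicative (ZMod n)) = n` (type synonym). [folklore] -/
private theorem natCard_multiplicative_zmod (n : ℕ) : Nat.card (Multiplicative (ZMod n)) = n := by
  show Nat.card (ZMod n) = n
  exact Nat.card_zmod n

/-- `#𝔽_{1^N} = N + 1` ("`D_k` … the monoid `C_{k−1} ∪ {0}`" has `k` elements). [cite: Deitmar2006ZetaKTheoryF1, §2 p. 143] -/
theorem card_F1Ext (N : ℕ) [NeZero N] : Nat.card (F1Ext N) = N + 1 := by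
  show Nat.card (Option (ZMod N)) = N + 1
  rw [Nat.card_eq_fintype_card, Fintype.card_option, ZMod.card]

/-- The units of a finite field form a cyclic group of order `#𝔽 − 1`, i.e. `𝔽ˣ ≅ μ_{q−1} = C_{q−1}`
(a chosen isomorphism). [cite: IrelandRosen1990, Ch. 4 §1 Thm. 1] -/
def unitsEquiv (F : Type*) [Field F] [Finite F] :
    Multiplicative (ZMod (Nat.card F - 1)) ≃* Fˣ :=
  mulEquivOfCyclicCardEq (by rw [natCard_multiplicative_zmod, Nat.card_units])

/-- **Deitmar: "if `q` is a prime power, then `D_q ≅ (𝔽_q, ×)`"** — the monoid `𝔽_{1^{q−1}} =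
μ_{q−1} ∪ {0}` is isomorphic, as a monoid (with zero), to the multiplicative monoid of any field with
`q` elements. [cite: Deitmar2006ZetaKTheoryF1, §2 p. 143] -/
def deitmarMonoidEquiv (F : Type*) [Field F] [Finite F] :
    F1Ext (Nat.card F - 1) ≃* F :=
  (MulEquiv.withZero (unitsEquiv F)).trans WithZero.withZeroUnitsEquiv

/-- Ring maps out of a ring are the same as `ℤ`-algebra maps (plumbing). [folklore] -/
def ringHomEquivIntAlgHom (R S : Type*) [Ring R] [Ring S] :
    (R →+* S) ≃ (R →ₐ[ℤ] S) where
  toFun f := f.toIntAlgHom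
  invFun g := g.toRingHom
  left_inv f := by ext; rfl
  right_inv g := by ext; rfl

/-- **`X_ℤ(S) = Hom_Ring(ℤ[A], S) ≃ Hom_Mon(A, (S, ×)) = X((S, ×))`**: the base extension `A ⊗ ℤ = ℤ[A]`
"defines a functor from monoids to rings which is left adjoint to the forgetful functor that sends a
ring `R` to the multiplicative monoid `(R, ×)`". [cite: Deitmar2006ZetaKTheoryF1, §1 p. 142] -/
def intPointsEquiv (A S : Type*) [CommMonoid A] [CommRing S] :
    (MonoidAlgebra ℤ A →+* S) ≃ Points A S :=
  (ringHomEquivIntAlgHom _ _).trans (MonoidAlgebra.lift ℤ S A).symm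

/-- `intPointsEquiv` evaluates a ring map on the monoid elements `a ∈ A ⊂ ℤ[A]`. [cite: Deitmar2006ZetaKTheoryF1, §1 p. 142] -/
@[simp] theorem intPointsEquiv_apply (A S : Type*) [CommMonoid A] [CommRing S]
    (φ : MonoidAlgebra ℤ A →+* S) (a : A) :
    intPointsEquiv A S φ a = φ (MonoidAlgebra.of ℤ A a) := rfl

/-- **`X(𝔽_{1^{q−1}}) ≃ X_ℤ(𝔽_q)` for affine `X = spec A`** (Connes–Consani Thm. 4.10 (2): the
`𝔽_{1^n}`-points "agree with the cardinality of `X(𝔽_q)` when `n = q − 1`", "the corresponding monoid is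
`𝔽₁[H]` for the cyclic group `H = ℤ/nℤ` of order `n = q − 1`"; Deitmar: "`#X_ℤ(𝔽_q) = #X(D_q)`",
"`D_q ≅ (𝔽_q, ×)`") — here as an explicit bijection, for every commutative monoid `A` (no
torsion-freeness needed) and every finite field. [cite: ConnesConsani2010SchemesF1, Thm. 4.10 (2) and proof]
[cite: Deitmar2006ZetaKTheoryF1, §2 p. 143 and Remark 1] -/
def pointsF1ExtEquiv (A F : Type*) [CommMonoid A] [Field F] [Finite F] :
    Points A (F1Ext (Nat.card F - 1)) ≃ (MonoidAlgebra ℤ A →+* F) :=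
  ((deitmarMonoidEquiv F).monoidHomCongrRightEquiv).trans (intPointsEquiv A F).symm

/-- **`#X(𝔽_{1^{q−1}}) = #X_ℤ(𝔽_q)`** for affine monoid schemes `X = spec A` and every finite field
`𝔽_q` (as `Nat.card`: for `A` not finitely generated both sides may be infinite, and are then `0`).
[cite: ConnesConsani2010SchemesF1, Thm. 4.10 (2)] [cite: Deitmar2006ZetaKTheoryF1, §2 p. 143 (`#X_ℤ(𝔽_q) = #X(D_q)`)] -/
theorem card_points_F1Ext (A F : Type*) [CommMonoid A] [Field F] [Finite F] :
    Nat.card (Points A (F1Ext (Nat.card F - 1))) = Nat.card (MonoidAlgebra ℤ A →+* F) :=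
  Nat.card_congr (pointsF1ExtEquiv A F)

/-- The affine line `𝔸¹ = spec 𝔽₁[t]` (free monoid on one generator, `A = ℕ` written
multiplicatively) has `#𝔸¹(𝔽_{1^N}) = #(μ_N ∪ {0}) = N + 1` points — matching `#𝔸¹(𝔽_q) = q` at
`N = q − 1` ("For the affine line `𝔸¹`, the number of points of `𝔸¹(𝔽_q)` is `N(q) = q`").
[cite: Deitmar2006ZetaKTheoryF1, §2 p. 143] [cite: ConnesConsani2010SchemesF1, Thm. 4.10 (2)] -/
theorem card_points_affineLine (N : ℕ) [NeZero N] :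
    Nat.card (Points (Multiplicative ℕ) (F1Ext N)) = N + 1 := by
  rw [← card_F1Ext N]
  exact Nat.card_congr (powersHom (F1Ext N)).symm

/-! ## §2. The Frobenius `x ↦ x^q` of `𝔽_{1^N}` and its fixed points -/

/-- The submonoid of fixed points of a monoid endomorphism (plumbing). [folklore] -/
def fixedSubmonoid {M : Type*} [Monoid M] (σ : M →* M) : Submonoid M where
  carrier := {x | σ x = x}
  one_mem' := map_one σ
  mul_mem' := by
    intro a b ha hb
    simp only [Set.mem_setOf_eq] at ha hb ⊢
    rw [map_mul, ha, hb]

/-- Membership in `fixedSubmonoid`. [folklore] -/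
@[simp] private theorem mem_fixedSubmonoid {M : Type*} [Monoid M] (σ : M →* M) (x : M) :
    x ∈ fixedSubmonoid σ ↔ σ x = x := Iff.rfl

/-- Points `f : A →* M` fixed under post-composition with `σ` are the points with values in the fixed
submonoid of `σ` (plumbing). [folklore] -/
def fixedHomEquiv {A M : Type*} [Monoid A] [Monoid M] (σ : M →* M) :
    {f : A →* M // σ.comp f = f} ≃ (A →* fixedSubmonoid σ) where
  toFun f := (f.1).codRestrict (fixedSubmonoid σ) (fun a => by
    rw [mem_fixedSubmonoid]
    exact DFunLike.congr_fun f.2 a)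
  invFun g := ⟨(fixedSubmonoid σ).subtype.comp g, by ext a; exact (g a).2⟩
  left_inv f := by ext; rfl
  right_inv g := by ext; rfl

/-- **The Frobenius `Fr_q : x ↦ x^q` of `𝔽_{1^N} = μ_N ∪ {0}`** (on roots of unity `ζ ↦ ζ^q`,
`0 ↦ 0`): Connes–Consani–Marcolli's `σ_k`, `e(r) ↦ e(kr)`, which for `k = p^ℓ` "coincide with the
Frobenius morphism" of `μ^{(m)} ⊗ K`. [cite: ConnesConsaniMarcolli2009, Prop. 2.1, Prop. 5.1 and Thm. 6.2 (b)] -/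
abbrev frob (N q : ℕ) : F1Ext N →* F1Ext N :=
  powMonoidHom q

/-- `Fr_q x = x^q`. [cite: ConnesConsaniMarcolli2009, Prop. 5.1] -/
theorem frob_apply (N q : ℕ) (x : F1Ext N) : frob N q x = x ^ q := rfl

/-- The `(q−1)`-torsion `μ_N[q−1] = {ζ ∈ μ_N : ζ^{q−1} = 1}` of the cyclic group `μ_N` (the part of
`μ_N` "rational over `𝔽_q`"; Deitmar: homomorphisms from the torsion to `C_{k−1}`). [cite: Deitmar2006ZetaKTheoryF1, §2 p. 143] -/
abbrev torsionKer (N q : ℕ) : Subgroup (Multiplicative (ZMod N)) :=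
  (powMonoidHom (q - 1) : Multiplicative (ZMod N) →* Multiplicative (ZMod N)).ker

/-- `#μ_N[q−1] = gcd(N, q − 1)` (number of solutions of `(q−1)a ≡ 0 (mod N)`). [cite: IrelandRosen1990, Ch. 3 §3 Prop. 3.3.1] -/
theorem natCard_torsionKer (N q : ℕ) [NeZero N] :
    Nat.card (torsionKer N q) = Nat.gcd N (q - 1) := by
  rw [torsionKer, IsCyclic.card_powMonoidHom_ker, natCard_multiplicative_zmod]

/-- In a group, `g^q = g ↔ g^{q−1} = 1` (`q ≥ 1`). [folklore] -/
private theorem pow_eq_self_iff {G : Type*} [Group G] {q : ℕ} (hq : q ≠ 0) (g : G) :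
    g ^ q = g ↔ g ^ (q - 1) = 1 := by
  conv_lhs => rw [← Nat.sub_add_cancel (Nat.one_le_iff_ne_zero.mpr hq), pow_succ]
  constructor
  · intro h
    exact mul_right_cancel (a := g ^ (q - 1)) (b := g) (c := 1) (by rwa [one_mul])
  · intro h
    rw [h, one_mul]

/-- The inclusion `μ_N[q−1] ∪ {0} → 𝔽_{1^N}`. [folklore] -/
private def kerIncl (N q : ℕ) : WithZero (torsionKer N q) →* F1Ext N :=
  (WithZero.map' (torsionKer N q).subtype : WithZero (torsionKer N q) →*₀ F1Ext N)

/-- `kerIncl 0 = 0`. [folklore] -/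
@[simp] private theorem kerIncl_zero (N q : ℕ) : kerIncl N q 0 = 0 := by
  simp [kerIncl]

/-- `kerIncl ζ = ζ` on `μ_N[q−1]`. [folklore] -/
@[simp] private theorem kerIncl_coe (N q : ℕ) (k : torsionKer N q) :
    kerIncl N q (k : WithZero (torsionKer N q)) = ((k : Multiplicative (ZMod N)) : F1Ext N) := by
  simp [kerIncl]

/-- `kerIncl` is injective. [folklore] -/
private theorem kerIncl_injective (N q : ℕ) : Function.Injective (kerIncl N q) := by
  intro x y hxy
  induction x using WithZero.recZeroCoe with
  | zero =>
    induction y using WithZero.recZeroCoe with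
    | zero => rfl
    | coe l => simp at hxy
  | coe k =>
    induction y using WithZero.recZeroCoe with
    | zero => simp at hxy
    | coe l =>
      rw [kerIncl_coe, kerIncl_coe, WithZero.coe_inj] at hxy
      rw [WithZero.coe_inj]
      exact Subtype.ext hxy

/-- `kerIncl` lands in the fixed points of `Fr_q`. [folklore] -/
private theorem kerIncl_mem_fixed (N q : ℕ) (hq : q ≠ 0) (x : WithZero (torsionKer N q)) :
    kerIncl N q x ∈ fixedSubmonoid (frob N q) := by
  rw [mem_fixedSubmonoid, frob_apply]
  induction x using WithZero.recZeroCoe with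
  | zero => rw [kerIncl_zero, zero_pow hq]
  | coe k =>
    have hk : ((k : Multiplicative (ZMod N))) ^ (q - 1) = 1 := k.2
    rw [kerIncl_coe, ← WithZero.coe_pow, (pow_eq_self_iff hq _).mpr hk]

/-- **Fixed points of `Fr_q` on `𝔽_{1^N}`**: `x^q = x` iff `x = 0` or `x = ζ ∈ μ_N` with `ζ^{q−1} = 1`.
[cite: Deitmar2006ZetaKTheoryF1, §2 p. 143 (no non-trivial homomorphism from the torsion part to `C_{k−1}` when `(e, k−1) = 1`)] -/
theorem mem_fixedSubmonoid_frob_iff (N q : ℕ) (hq : q ≠ 0) (x : F1Ext N) :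
    x ∈ fixedSubmonoid (frob N q) ↔
      x = 0 ∨ ∃ k : torsionKer N q, x = ((k : Multiplicative (ZMod N)) : F1Ext N) := by
  rw [mem_fixedSubmonoid, frob_apply]
  induction x using WithZero.recZeroCoe with
  | zero => simp [zero_pow hq]
  | coe g =>
    rw [← WithZero.coe_pow, WithZero.coe_inj, pow_eq_self_iff hq]
    constructor
    · intro h
      exact Or.inr ⟨⟨g, h⟩, rfl⟩
    · rintro (h | ⟨k, hk⟩)
      · exact absurd h WithZero.coe_ne_zero
      · rw [WithZero.coe_inj] at hk
        rw [hk]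
        exact k.2

/-- `μ_N[q−1] ∪ {0} ≃* Fix(Fr_q | 𝔽_{1^N})` (plumbing). [folklore] -/
private def kerEquivFixed (N q : ℕ) (hq : q ≠ 0) :
    WithZero (torsionKer N q) ≃* fixedSubmonoid (frob N q) :=
  MulEquiv.ofBijective
    ((kerIncl N q).codRestrict (fixedSubmonoid (frob N q)) (kerIncl_mem_fixed N q hq))
    (by
      constructor
      · intro x y hxy
        apply kerIncl_injective N q
        simpa using congrArg Subtype.val hxy
      · rintro ⟨x, hx⟩
        rcases (mem_fixedSubmonoid_frob_iff N q hq x).mp hx with h | ⟨k, hk⟩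
        · exact ⟨0, Subtype.ext (by simp [h])⟩
        · exact ⟨(k : WithZero (torsionKer N q)), Subtype.ext (by simp [hk])⟩)

/-- **`Fix(Fr_q | 𝔽_{1^N}) ≅ 𝔽_{1^{gcd(N, q−1)}}`** (`N, q ≥ 1`): the fixed submonoid of `x ↦ x^q` on
`μ_N ∪ {0}` is `μ_N[q−1] ∪ {0}`, and `μ_N[q−1]` is cyclic of order `gcd(N, q − 1)`. [cite: IrelandRosen1990, Ch. 3 §3 Prop. 3.3.1]
[cite: Deitmar2006ZetaKTheoryF1, §2 p. 143] -/
def fixedEquivF1Ext (N q : ℕ) [NeZero N] (hq : q ≠ 0) :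
    fixedSubmonoid (frob N q) ≃* F1Ext (Nat.gcd N (q - 1)) :=
  (kerEquivFixed N q hq).symm.trans
    (MulEquiv.withZero (mulEquivOfCyclicCardEq (G := torsionKer N q)
      (G' := Multiplicative (ZMod (Nat.gcd N (q - 1))))
      (by rw [natCard_torsionKer, natCard_multiplicative_zmod])))

/-- **Frobenius-fixed `𝔽_{1^N}`-points are `𝔽_{1^{gcd(N, q−1)}}`-points**: for `X = spec A`, the points
`f ∈ X(𝔽_{1^N}) = Hom(A, μ_N ∪ {0})` with `Fr_q ∘ f = f` correspond bijectively to
`X(𝔽_{1^{gcd(N, q−1)}})`. [cite: ConnesConsaniMarcolli2009, Thm. 6.2 (b) (the `σ_k` as Frobenius)]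
[cite: Deitmar2006ZetaKTheoryF1, §2 p. 143 (`X(spec D_k) = Hom(A, D_k)`)] -/
def frobFixedPointsEquiv (A : Type*) [Monoid A] (N q : ℕ) [NeZero N] (hq : q ≠ 0) :
    {f : Points A (F1Ext N) // (frob N q).comp f = f} ≃ Points A (F1Ext (Nat.gcd N (q - 1))) :=
  (fixedHomEquiv (frob N q)).trans (fixedEquivF1Ext N q hq).monoidHomCongrRightEquiv

/-- `#{f ∈ X(𝔽_{1^N}) : Fr_q ∘ f = f} = #X(𝔽_{1^{gcd(N, q−1)}})`. [cite: ConnesConsaniMarcolli2009, Thm. 6.2 (b)]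
[cite: Deitmar2006ZetaKTheoryF1, §2 p. 143] -/
theorem card_frobFixedPoints (A : Type*) [Monoid A] (N q : ℕ) [NeZero N] (hq : q ≠ 0) :
    Nat.card {f : Points A (F1Ext N) // (frob N q).comp f = f} =
      Nat.card (Points A (F1Ext (Nat.gcd N (q - 1)))) :=
  Nat.card_congr (frobFixedPointsEquiv A N q hq)

/-- **Weil-type count for affine monoid schemes: for `q − 1 ∣ N` (`q = #𝔽`), the number of
`𝔽_{1^N}`-points of `X = spec A` fixed by the Frobenius `Fr_q` equals `#X_ℤ(𝔽_q) = #Hom(ℤ[A], 𝔽_q)`**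
(`gcd(N, q−1) = q − 1`, then `X(𝔽_{1^{q−1}}) ≃ X_ℤ(𝔽_q)` by Deitmar / Connes–Consani).
[cite: ConnesConsani2010SchemesF1, Thm. 4.10 (2)] [cite: Deitmar2006ZetaKTheoryF1, §2 p. 143 and Remark 1]
[cite: ConnesConsaniMarcolli2009, Thm. 6.2 (b)] -/
theorem card_frobFixedPoints_eq_card_intPoints (A F : Type*) [CommMonoid A] [Field F] [Finite F]
    {N : ℕ} [NeZero N] (hN : Nat.card F - 1 ∣ N) :
    Nat.card {f : Points A (F1Ext N) // (frob N (Nat.card F)).comp f = f} =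
      Nat.card (MonoidAlgebra ℤ A →+* F) := by
  have hq : Nat.card F ≠ 0 := Nat.card_pos.ne'
  rw [card_frobFixedPoints A N (Nat.card F) hq, Nat.gcd_eq_right hN, card_points_F1Ext]

end Literature.AlgebraicGeometry.F1Schemes
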